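import Summits.RiemannHypothesis.RiemannHypothesis.Theorems.PfPersistenceMarkovCore
import HarnessLib

/-!
# PF persistence (theory 1, edge law): THE MARKOV CORE OF A NON-NEGATIVE WEIGHT TABLE, III —
# the non-negative minimiser is a.e. strictly positive on the open window

Helper file (`--supports stmt-RiemannHypothesis-19953`); mechanism/rigidity campaign; no RH claims.
Third of four files on kernel Perron–Frobenius for the Markov core `𝓔^w_a = tableDirichletEnergy a w`
of EVERY non-negative weight table at EVERY window `a > 0` (see `PfPersistenceMarkovCore`).

* `core_nonneg_minimizer_ae_pos` — a non-negative normalised minimiser `Φ` of `𝓔^w_a` over the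
  finite-energy class satisfies `Φ > 0` a.e. on `(-a, a)`: the first-order deficit of
  `√(Φ² + r²ψ²)` against a window bump `ψ` charges the pairs (zero of `Φ`) × (`Φ ≥ ψ > 0`) at every
  length, and the archimedean density is positive at every length (positivity-improving half of
  Perron–Frobenius, variationally; the tree's `nonneg_minimizer_ae_pos` is the case `w = Λ(n)/√n`).

## References

* M. Reed, B. Simon, *Methods of Modern Mathematical Physics IV* (1978), §XIII.12, Thms XIII.43–44.
* Z.-Q. Chen, M. Fukushima, *Symmetric Markov Processes, Time Change, and Boundary Theory* (2012),
  §1.1 Def. 1.1.2, Thm 1.1.3(e) (normal contractions operate on a Dirichlet form).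
* E. H. Lieb, M. Loss, *Analysis*, 2nd ed. (2001), Thm 7.8 (convexity of the energy in the density).
* E. Bombieri, Rend. Mat. Acc. Lincei (9) 11 (2000) 183–233, Thm 2 (the windowed explicit formula).
-/

set_option linter.dupNamespace false

noncomputable section

open MeasureTheory Set Filter
open scoped Topology ENNReal NNReal ComplexConjugate

namespace Summit.RiemannHypothesis.RiemannHypothesis.Theorems.PfPersistence

open Literature.NumberTheory.LFunctions
open Summit.RiemannHypothesis.RiemannHypothesis.Theorems.WeilWindowFlowWindowLipschitz
  (stub_localizedCut_aesm_weilIncrement)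
open Summit.RiemannHypothesis.RiemannHypothesis.Theorems.WeilGroundStateMarkovPart
open Summit.RiemannHypothesis.RiemannHypothesis.Theorems.PfPersistenceDownCone (zetaTable)

/-! ## §5 Positivity of the non-negative minimiser -/

/-- **The non-negative minimiser of the core is a.e. strictly positive on the open window**
(positivity-improving half of Perron–Frobenius, variationally; the tree's `nonneg_minimizer_ae_pos`
is the case `w = Λ(n)/√n`): the first-order deficit of `√(Φ² + r²ψ²)` against a window bump `ψ`
charges the pairs `(zero of Φ) × (Φ ≥ ψ > 0)` at every length, `a > 0`. [cite: ReedSimonIV1978, §XIII.12 Thm XIII.44] -/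
theorem core_nonneg_minimizer_ae_pos {a E : ℝ} {w : ℕ → ℝ} (hw : ∀ n ∈ weilPrimeIndex a, 0 ≤ w n)
    (ha : 0 < a) {Φ : ℝ → ℝ}
    (hm : Measurable Φ) (h0 : ∀ x, 0 ≤ Φ x) (hL : MemLp Φ 2)
    (hs : ∀ x, x ∉ Icc (-a) a → Φ x = 0) (hn : ∫ x, Φ x ^ 2 = 1)
    (hfin : IntegrableOn (fun t ↦ weilArchDensity t * weilIncrement (fun x ↦ (Φ x : ℂ)) t)
      (Ioi 0))
    (hE : tableDirichletEnergy a w (fun x ↦ (Φ x : ℂ)) ≤ E)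
    (hbot : ∀ v : ℝ → ℂ, MemLp v 2 → (∀ x, x ∉ Icc (-a) a → v x = 0) →
      IntegrableOn (fun t ↦ weilArchDensity t * weilIncrement v t) (Ioi 0) →
      E * ∫ x, ‖v x‖ ^ 2 ≤ tableDirichletEnergy a w v) :
    ∀ᵐ x : ℝ, x ∈ Ioo (-a) a → 0 < Φ x := by
  obtain ⟨ψ, hmψ, hψ0, hψs, hψpos, hnψ, hψt⟩ := exists_window_bump ha
  -- `L²` data
  have hLc : MemLp (fun x ↦ (Φ x : ℂ)) 2 := hL.ofReal
  have hLψc : MemLp (fun x ↦ (ψ x : ℂ)) 2 := hψt.memLp_two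
  have hLψ : MemLp ψ 2 := by
    refine (memLp_two_iff_integrable_sq_norm hmψ.aestronglyMeasurable).2 ?_
    have := (memLp_two_iff_integrable_sq_norm hLψc.1).1 hLψc
    simpa only [Complex.norm_real, Real.norm_eq_abs, sq_abs] using this
  have hi : Integrable fun x ↦ Φ x ^ 2 := by
    have := (memLp_two_iff_integrable_sq_norm hL.1).1 hL
    simpa only [Real.norm_eq_abs, sq_abs] using this
  have hiψ : Integrable fun x ↦ ψ x ^ 2 := by
    have := (memLp_two_iff_integrable_sq_norm hLψ.1).1 hLψ
    simpa only [Real.norm_eq_abs, sq_abs] using this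
  have hfinψ := integrableOn_weilArchDensity_mul_weilIncrement hψt
  set C : ℝ := |tableDirichletEnergy a w (fun x ↦ (ψ x : ℂ)) - E| with hCdef
  -- the exceptional set and the good set
  set Z : Set ℝ := {x | x ∈ Ioo (-a) a ∧ Φ x = 0} with hZdef
  set P : Set ℝ := {y | ψ y ≤ Φ y ∧ 0 < Φ y} with hPdef
  have hZm : MeasurableSet Z := measurableSet_Ioo.inter (hm (measurableSet_singleton 0))
  have hPm : MeasurableSet P := (measurableSet_le hmψ hm).inter (measurableSet_lt measurable_const hm)
  have hP : volume P ≠ 0 := measure_le_and_pos_ne_zero h0 hL hLψ hn hnψ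
  -- the test kernel
  set k₀ : ℝ → ℝ → ℝ := fun x y ↦ if x ∈ Z ∧ y ∈ P then ψ x * Φ y else 0 with hk₀def
  have hk₀0 : ∀ x y, 0 ≤ k₀ x y := fun x y ↦ by
    simp only [hk₀def]
    split_ifs
    · exact mul_nonneg (hψ0 x) (h0 y)
    · exact le_rfl
  have hk₀m : Measurable (Function.uncurry k₀) := by
    have e : Function.uncurry k₀ = fun p : ℝ × ℝ ↦ if p.1 ∈ Z ∧ p.2 ∈ P then ψ p.1 * Φ p.2 else 0 := by
      funext p; rfl
    rw [e]
    refine Measurable.ite ?_ ((hmψ.comp measurable_fst).mul (hm.comp measurable_snd))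
      measurable_const
    exact (measurable_fst hZm).inter (measurable_snd hPm)
  set k : ℝ → ℝ → ℝ := fun x y ↦ k₀ x y + k₀ y x with hkdef
  have hk0 : ∀ x y, 0 ≤ k x y := fun x y ↦ add_nonneg (hk₀0 x y) (hk₀0 y x)
  have hksymm : ∀ x y, k x y = k y x := fun x y ↦ add_comm _ _
  have hkm : Measurable (Function.uncurry k) := by
    have e : Function.uncurry k = fun p : ℝ × ℝ ↦
        Function.uncurry k₀ p + Function.uncurry k₀ (p.2, p.1) := by
      funext p; rfl
    rw [e]
    exact hk₀m.add (hk₀m.comp (measurable_snd.prodMk measurable_fst))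
  set K : ℝ≥0∞ := ∫⁻ t in Ioi (0 : ℝ), ∫⁻ x, ENNReal.ofReal (weilArchDensity t * k x (x + t))
    with hKdef
  -- the deficit estimate for `M_r = √(Φ² + r²ψ²)`
  have key : ∀ r : ℝ, 0 < r → r ≤ 1 / 2 → ENNReal.ofReal r * K ≤ ENNReal.ofReal (2 * (r ^ 2 * C)) := by
    intro r hr hr2
    set M : ℝ → ℝ := fun x ↦ Real.sqrt (1 * Φ x ^ 2 + r ^ 2 * ψ x ^ 2) with hMdef
    set F : ℝ → ℝ → ℝ := fun x y ↦
      2 * (M x * M y - (1 * Φ x * Φ y + r ^ 2 * ψ x * ψ y)) with hFdef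
    have hw₁ : (0 : ℝ) ≤ r ^ 2 := sq_nonneg r
    have hF0 : ∀ x y, 0 ≤ F x y := fun x y ↦
      mul_nonneg zero_le_two (geomMean_deficit_nonneg zero_le_one hw₁)
    have hFsymm : ∀ x y, F x y = F y x := fun x y ↦ by simp only [hFdef]; ring
    have hMm : Measurable M := by
      simp only [hMdef]
      exact ((measurable_const.mul (hm.pow_const 2)).add
        (measurable_const.mul (hmψ.pow_const 2))).sqrt
    have hid : ∀ x y, ‖(M y : ℂ) - (M x : ℂ)‖ ^ 2 + F x y =
        1 * ‖(Φ y : ℂ) - (Φ x : ℂ)‖ ^ 2 + r ^ 2 * ‖(ψ y : ℂ) - (ψ x : ℂ)‖ ^ 2 := by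
      intro x y
      simp only [norm_ofReal_sub_sq, hFdef, hMdef]
      exact geomMean_sq_identity zero_le_one hw₁
    have hMsq : ∀ x, ‖(M x : ℂ)‖ ^ 2 = Φ x ^ 2 + r ^ 2 * ψ x ^ 2 := fun x ↦ by
      rw [Complex.norm_real, Real.norm_eq_abs, sq_abs, hMdef, Real.sq_sqrt (by positivity)]
      ring
    have hMc : MemLp (fun x ↦ (M x : ℂ)) 2 := by
      refine (memLp_two_iff_integrable_sq_norm
        (Complex.measurable_ofReal.comp hMm).aestronglyMeasurable).2 ?_
      show Integrable (fun x ↦ ‖(M x : ℂ)‖ ^ 2)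
      exact (hi.add (hiψ.const_mul _)).congr (Eventually.of_forall fun x ↦ (hMsq x).symm)
    have hMnorm : ∫ x, ‖(M x : ℂ)‖ ^ 2 = 1 + r ^ 2 := by
      simp only [hMsq]
      rw [integral_add hi (hiψ.const_mul _), integral_const_mul, hn, hnψ, mul_one]
    have hMs : ∀ x, x ∉ Icc (-a) a → (M x : ℂ) = 0 := fun x hx ↦ by
      simp only [hMdef, hs x hx, hψs x hx]
      norm_num
    obtain ⟨hfinM, hdef⟩ := table_lintegral_deficit_le hw hMc hLc hLψc hF0 hid hfin hfinψ
    have hEM : E * (1 + r ^ 2) ≤ tableDirichletEnergy a w (fun x ↦ (M x : ℂ)) := by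
      have := hbot _ hMc hMs hfinM
      rwa [hMnorm] at this
    have hdef' : ∫⁻ t in Ioi (0 : ℝ), ∫⁻ x, ENNReal.ofReal (weilArchDensity t * F x (x + t)) ≤
        ENNReal.ofReal (r ^ 2 * C) := by
      refine hdef.trans (ENNReal.ofReal_le_ofReal ?_)
      have h1 : tableDirichletEnergy a w (fun x ↦ (ψ x : ℂ)) - E ≤ C := le_abs_self _
      nlinarith [h1, hEM, hE]
    -- pointwise: `r k ≤ 2 F`
    have hptw : ∀ x y, r * k x y ≤ 2 * F x y := by
      have hone : ∀ x y, r * k₀ x y ≤ F x y := by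
        intro x y
        simp only [hk₀def]
        split_ifs with hxy
        · obtain ⟨⟨-, hx0⟩, hyle, -⟩ := hxy
          have := geomMean_deficit_lower (p₁ := ψ x) hr.le hr2 hx0 (hψ0 x) (hψ0 y) hyle
          simp only [hFdef, hMdef]
          linarith
        · rw [mul_zero]; exact hF0 x y
      intro x y
      have h1 := hone x y
      have h2 := hone y x
      rw [← hFsymm x y] at h2
      simp only [hkdef]
      linarith
    -- integrate
    have hlhs : ENNReal.ofReal r * K =
        ∫⁻ t in Ioi (0 : ℝ), ∫⁻ x, ENNReal.ofReal (weilArchDensity t * (r * k x (x + t))) := by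
      rw [hKdef, ← lintegral_const_mul' _ _ ENNReal.ofReal_ne_top]
      refine lintegral_congr fun t ↦ ?_
      rw [← lintegral_const_mul' _ _ ENNReal.ofReal_ne_top]
      refine lintegral_congr fun x ↦ ?_
      rw [← ENNReal.ofReal_mul hr.le]
      congr 1
      ring
    have hrhs : ∫⁻ t in Ioi (0 : ℝ), ∫⁻ x, ENNReal.ofReal (weilArchDensity t * (2 * F x (x + t))) =
        2 * ∫⁻ t in Ioi (0 : ℝ), ∫⁻ x, ENNReal.ofReal (weilArchDensity t * F x (x + t)) := by
      rw [← lintegral_const_mul' _ _ ENNReal.ofNat_ne_top]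
      refine lintegral_congr fun t ↦ ?_
      rw [← lintegral_const_mul' _ _ ENNReal.ofNat_ne_top]
      refine lintegral_congr fun x ↦ ?_
      rw [show (2 : ℝ≥0∞) = ENNReal.ofReal 2 by norm_num, ← ENNReal.ofReal_mul zero_le_two]
      congr 1
      ring
    have hmono : ∫⁻ t in Ioi (0 : ℝ), ∫⁻ x, ENNReal.ofReal (weilArchDensity t * (r * k x (x + t))) ≤
        ∫⁻ t in Ioi (0 : ℝ), ∫⁻ x, ENNReal.ofReal (weilArchDensity t * (2 * F x (x + t))) := by
      refine lintegral_mono fun t ↦ lintegral_mono fun x ↦ ?_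
      rcases le_or_gt (weilArchDensity t) 0 with hρ | hρ
      · rw [ENNReal.ofReal_of_nonpos (mul_nonpos_of_nonpos_of_nonneg hρ
          (mul_nonneg hr.le (hk0 _ _)))]
        exact bot_le
      · exact ENNReal.ofReal_le_ofReal (mul_le_mul_of_nonneg_left (hptw _ _) hρ.le)
    calc ENNReal.ofReal r * K
        ≤ 2 * ∫⁻ t in Ioi (0 : ℝ), ∫⁻ x, ENNReal.ofReal (weilArchDensity t * F x (x + t)) := by
          rw [hlhs, ← hrhs]; exact hmono
      _ ≤ 2 * ENNReal.ofReal (r ^ 2 * C) := by gcongr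
      _ = ENNReal.ofReal (2 * (r ^ 2 * C)) := by
          rw [ENNReal.ofReal_mul zero_le_two]; norm_num
  -- hence `K = 0`
  have hKle : ∀ n : ℕ, K ≤ ENNReal.ofReal (C * (1 / ((n : ℝ) + 1))) := by
    intro n
    have hr : (0 : ℝ) < 1 / (2 * ((n : ℝ) + 1)) := by positivity
    have hr2 : 1 / (2 * ((n : ℝ) + 1)) ≤ 1 / 2 :=
      one_div_le_one_div_of_le two_pos (by nlinarith [n.cast_nonneg (α := ℝ)])
    have h := key _ hr hr2
    have e : ENNReal.ofReal (2 * ((1 / (2 * ((n : ℝ) + 1))) ^ 2 * C)) =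
        ENNReal.ofReal (1 / (2 * ((n : ℝ) + 1))) * ENNReal.ofReal (C * (1 / ((n : ℝ) + 1))) := by
      rw [← ENNReal.ofReal_mul hr.le]
      congr 1
      field_simp
    rw [e] at h
    exact (ENNReal.mul_le_mul_iff_right ((ENNReal.ofReal_pos.2 hr).ne') ENNReal.ofReal_ne_top).1 h
  have hK : K = 0 := by
    refine le_antisymm ?_ bot_le
    have ht : Tendsto (fun n : ℕ ↦ ENNReal.ofReal (C * (1 / ((n : ℝ) + 1)))) atTop (𝓝 0) := by
      have h1 := (tendsto_one_div_add_atTop_nhds_zero_nat (𝕜 := ℝ)).const_mul C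
      rw [mul_zero] at h1
      have h2 := ENNReal.tendsto_ofReal h1
      rwa [ENNReal.ofReal_zero] at h2
    exact ge_of_tendsto' ht hKle
  -- a.e. pairs: `Z × P` is null
  have hae : ∀ᵐ x : ℝ, ∀ᵐ y : ℝ, ENNReal.ofReal (k x y) = 0 :=
    ae_pair_eq_zero_of_ae_lintegral_shift (F := fun x y ↦ ENNReal.ofReal (k x y))
      (ENNReal.measurable_ofReal.comp hkm) (fun x y ↦ by rw [hksymm])
      (ae_lintegral_shift_eq_zero hkm hk0 (by rw [← hKdef]; exact hK))
  have hnot : ∀ᵐ x : ℝ, x ∈ Z → ∀ᵐ y : ℝ, y ∉ P := by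
    filter_upwards [hae] with x hx hxZ
    filter_upwards [hx] with y hy hyP
    have h1 : k x y = 0 := le_antisymm (ENNReal.ofReal_eq_zero.1 hy) (hk0 x y)
    have h2 : k₀ x y = ψ x * Φ y := by simp only [hk₀def, if_pos (And.intro hxZ hyP)]
    have h3 : 0 < ψ x * Φ y := mul_pos (hψpos x hxZ.1) hyP.2
    have h4 : k₀ x y ≤ k x y := le_add_of_nonneg_right (hk₀0 y x)
    linarith
  have hZ0 : volume Z = 0 := by
    rw [measure_eq_zero_iff_ae_notMem]
    filter_upwards [hnot] with x hx hxZ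
    exact hP (measure_eq_zero_iff_ae_notMem.2 (hx hxZ))
  -- conclusion
  rw [ae_iff]
  have hsub : {x : ℝ | ¬(x ∈ Ioo (-a) a → 0 < Φ x)} ⊆ Z := by
    intro x hx
    have hx' : x ∈ Ioo (-a) a ∧ ¬ 0 < Φ x := Classical.not_imp.1 hx
    exact ⟨hx'.1, le_antisymm (not_lt.1 hx'.2) (h0 x)⟩
  exact measure_mono_null hsub hZ0

end Summit.RiemannHypothesis.RiemannHypothesis.Theorems.PfPersistence

end
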